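import Literature.Probability.RandomPlanarGeometry.HexSAWPolygonCellsSticks
import HarnessLib

/-!
# Cell calculus for honeycomb polygon surgery, XII: every peeled hexagon sits on an up-right STICK over a host of the base (LEMMA D)

Topic `Literature/Probability/RandomPlanarGeometry` (lane «pcv-sawmu», a-p4 g21; sequel of `HexSAWPolygonCellsSticks.lean`).

LEMMA D of `HOME/pub-sawmu-a-p4/g21/omega/THEOREM-OMEGA-g21.md` §3 in closed form: for every `c ∈ S ∖ peel S` there are a host `h` of the
base `peel S` and `i ≥ 1` with `c = UR^i h = (h.x + i, h.y + i)` and the whole segment `UR h, …, UR^i h` inside `S ∖ peel S`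
(`exists_host_stick_of_mem_sdiff_peel`).  So `S ∖ peel S` is covered by up-right sticks standing on hosts of the base; with part VIII's
diagonal separation of ports and part IV's ray lemma this is what THEOREM V consumes.

Sources: N. Madras, G. Slade, *The Self-Avoiding Walk* (1993), §3.2, proof of Theorem 3.2.3 [MadrasSlade1993]; I. Jensen, J. Phys.: Conf.
Ser. 42 (2006) 163 [Jensen2006HoneycombPolygons].  Label (lane): LANE INFRASTRUCTURE; nothing new in writing.
-/

open Finset

namespace Literature.Probability.RandomPlanarGeometry.SAW

namespace HexCell

/-- `UR^i h = (h.x + i, h.y + i)`. [cite: MadrasSlade1993, §3.2 (proof of Theorem 3.2.3)] -/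
def urIter (h : Cell) (i : ℕ) : Cell := (h.1 + (i : ℤ), h.2 + (i : ℤ))

/-- `UR^0 h = h`. [cite: MadrasSlade1993, §3.2 (proof of Theorem 3.2.3)] -/
@[simp] theorem urIter_zero (h : Cell) : urIter h 0 = h := by ext <;> simp [urIter]

/-- `UR^{i+1} h = UR (UR^i h)`. [cite: MadrasSlade1993, §3.2 (proof of Theorem 3.2.3)] -/
theorem urIter_succ (h : Cell) (i : ℕ) : urIter h (i + 1) = UR (urIter h i) := by
  ext <;> simp [urIter, UR] <;> ring

/-- `LL (UR^{i+1} h) = UR^i h`. [cite: MadrasSlade1993, §3.2 (proof of Theorem 3.2.3)] -/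
theorem ll_urIter_succ (h : Cell) (i : ℕ) : LL (urIter h (i + 1)) = urIter h i := by
  ext <;> simp [urIter, LL] <;> ring

/-- `UR^{i} (LL c)` shifted: `urIter (LL c) (i + 1) = urIter c i`. [cite: MadrasSlade1993, §3.2 (proof of Theorem 3.2.3)] -/
theorem urIter_ll_succ (c : Cell) (i : ℕ) : urIter (LL c) (i + 1) = urIter c i := by
  ext <;> simp [urIter, LL]

open Classical in
/-- ★ **LEMMA D (stick structure)**: every peeled hexagon `c ∈ S ∖ peel S` is `UR^i h` for a host `h` of the base and some `i ≥ 1`, with the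
whole stick `UR^1 h, …, UR^i h` inside the peeled part. [cite: MadrasSlade1993, §3.2 (proof of Theorem 3.2.3: the removed units stack over the core)] -/
theorem exists_host_stick_of_mem_sdiff_peel {S : Finset Cell} {c : Cell} (hc : c ∈ S \ peel S) :
    ∃ h : Cell, ∃ i : ℕ, IsHost (peel S) h ∧ 1 ≤ i ∧ urIter h i = c ∧ ∀ j, 1 ≤ j → j ≤ i → urIter h j ∈ S \ peel S := by
  induction S using Finset.strongInduction generalizing c with
  | H S ih =>
    by_cases hp : ∃ m, Peelable S m
    · obtain ⟨m, hm⟩ := hp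
      have hstep := sdiff_peel_eq_insert hm
      have hpe : peel S = peel (S.erase m) := peel_eq_peel_erase hm
      have hsub : S.erase m \ peel (S.erase m) ⊆ S \ peel S := by
        intro x hx; rw [hstep, mem_insert]; exact Or.inr hx
      have hc' := hc
      rw [hstep, mem_insert] at hc'
      rcases hc' with rfl | hc'
      · -- the fresh top `c = m`: its support is a host of `S.erase c`
        have hh : IsHost (S.erase c) (LL c) := isHost_erase_ll_of_isSpikeTop hm.1
        by_cases hin : LL c ∈ peel (S.erase c)
        · refine ⟨LL c, 1, ?_, le_rfl, ?_, ?_⟩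
          · rw [hpe]; exact hh.mono (peel_subset _) hin
          · rw [urIter_ll_succ, urIter_zero]
          · intro j hj1 hj2
            have : j = 1 := by omega
            subst this
            rw [urIter_ll_succ, urIter_zero]; exact hc
        · -- the support was itself peeled: recurse on it inside `S.erase c`
          have hll : LL c ∈ S.erase c \ peel (S.erase c) := mem_sdiff.2 ⟨hh.1, hin⟩
          obtain ⟨h, i, hhost, hi, heq, hseg⟩ := ih _ (erase_ssubset hm.mem) hll
          refine ⟨h, i + 1, ?_, by omega, ?_, ?_⟩
          · rw [hpe]; exact hhost
          · rw [urIter_succ, heq]; ext <;> simp [UR, LL]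
          · intro j hj1 hj2
            rcases Nat.lt_or_ge j (i + 1) with hlt | hge
            · exact hsub (hseg j hj1 (by omega))
            · have : j = i + 1 := by omega
              subst this
              rw [urIter_succ, heq]
              have e : UR (LL c) = c := by ext <;> simp [UR, LL]
              rw [e]; exact hc
      · obtain ⟨h, i, hhost, hi, heq, hseg⟩ := ih _ (erase_ssubset hm.mem) hc'
        exact ⟨h, i, by rw [hpe]; exact hhost, hi, heq, fun j hj1 hj2 => hsub (hseg j hj1 hj2)⟩
    · rw [peel_eq_self hp, sdiff_self] at hc
      exact absurd hc (Finset.notMem_empty c)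

/-- Consequently a peeled hexagon is not a host-free floater: its whole lower-left diagonal down to the base is in `S`.
[cite: MadrasSlade1993, §3.2 (proof of Theorem 3.2.3)] -/
theorem urIter_mem_of_mem_sdiff_peel {S : Finset Cell} {c : Cell} (hc : c ∈ S \ peel S) :
    ∃ h : Cell, ∃ i : ℕ, h ∈ peel S ∧ 1 ≤ i ∧ urIter h i = c ∧ ∀ j, j ≤ i → urIter h j ∈ S := by
  obtain ⟨h, i, hhost, hi, heq, hseg⟩ := exists_host_stick_of_mem_sdiff_peel hc
  refine ⟨h, i, hhost.1, hi, heq, fun j hj => ?_⟩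
  rcases Nat.eq_zero_or_pos j with rfl | hj0
  · rw [urIter_zero]; exact peel_subset _ hhost.1
  · exact (mem_sdiff.1 (hseg j hj0 hj)).1

end HexCell

end Literature.Probability.RandomPlanarGeometry.SAW
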